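import Literature.Topology.FourManifolds.HomotopySpheresHCobordismProofs
import Literature.Topology.FourManifolds.HomotopySpheresClosedModelHCobordism
import Literature.Topology.FourManifolds.HomotopySpheresGroupResidue
import Literature.Topology.FourManifolds.WallBoundingHandlebodyProofs
import Literature.Topology.FourManifolds.HCobordismSlideStepSign
import Literature.Topology.FourManifolds.HCobordismWhitneyIsotopyProofs
import HarnessLib

/-!
# Discharged facts: the consequences of Milnor's h-cobordism theorem recorded as named facts hold
# (Kervaire–Milnor 1963, p. 505; Milnor 1965, Thm. 9.1–9.2; Wall 1964, Lemma 2)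

The directory decomposed Milnor's proof of the h-cobordism theorem (*Lectures on the h-cobordism
theorem*, 1965) into leaves, and reduced four named facts to the two leaves that remained named
facts longest — the Basis Theorem 7.6 on a slab (`Cobordism.Milnor1965_basisTheorem_slab`) and
Whitney's Thm. 6.6 with its Remark (`Milnor1965_whitney_isotopy`) — by theorems whose docstrings
announce: "the discharge `…_holds` is this theorem applied to the two remaining `_holds`, once they
land".  Both leaves ARE theorems of the tree (`Cobordism.Milnor1965_basisTheorem_slab_holds`,
`HCobordismSlideStepSign.lean`; `Milnor1965_whitney_isotopy_holds`,
`HCobordismWhitneyIsotopyProofs.lean`; Cor. 7.3 on a slab and Wall's duality step earlier: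
`Cobordism.Milnor1965_intersectionNumber_slab_holds`,
`Cobordism.isZero_relativeSingularHomology_inl_of_inr_le_holds`), but the announced one-line
discharges were never written.  This file writes them (no statement changed, no definition, no new
named fact, D-0026; net Literature debt **−4**):

* `HomotopySphere.isHCobordant_iff_nonempty_diffeomorph_of_five_le_holds` — **two homotopy
  `n`-spheres, `n ≥ 5`, are h-cobordant iff they are diffeomorphic** (Kervaire–Milnor 1963, p. 505,
  Remark, from Smale; Milnor 1965, proof of Thm. 9.1), by
  `isHCobordant_iff_nonempty_diffeomorph_of_five_le_of_two_leaves`;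
* `HomotopySphere.nonempty_chartedSpace_closedModel_holds` — the closed model of a null-cobordism
  of a homotopy sphere is a charted smooth manifold (the tree's packaging of Milnor Thm. 9.1 /
  Kosinski X.(3.3)), by `nonempty_chartedSpace_closedModel_of_three_leaves`;
* `exists_commGroup_homotopySphereClass_of_ne_three_holds` — **`Θₙ` is an abelian group under
  connected sum for `n ≠ 3`** (Kervaire–Milnor 1963, Thm. 1.1 with §2; the case `n = 3` needs the
  Poincaré conjecture and is a separate fact of the tree), by
  `exists_commGroup_homotopySphereClass_of_ne_three_of_two_leaves`;
* `exists_handlebody_isHCobordant_boundary_holds` — **Wall 1964, Lemma 2**: a simply connected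
  closed smooth `4`-manifold bounding a suitable simply connected `W` is h-cobordant to the boundary
  of a handlebody `ℋ(D⁵, k, 2)`, by `exists_handlebody_isHCobordant_boundary_of_basisTheorem`.

## References

* M. A. Kervaire, J. W. Milnor, *Groups of homotopy spheres: I*, Ann. of Math. 77 (1963), Thm. 1.1
  (p. 504), Remark p. 505, §2 (pp. 505–507). [KervaireMilnorAnnals1963]
* J. Milnor, *Lectures on the h-cobordism theorem*, Princeton (1965), Thm. 6.6 and Remark
  (PDF pp. 38–39), Cor. 7.3 (PDF p. 47), Thm. 7.6 (PDF p. 50), Thm. 9.1–9.2 (PDF p. 57).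
  [MilnorHCobordism1965]
* C. T. C. Wall, *On simply-connected 4-manifolds*, J. London Math. Soc. 39 (1964), Lemma 2
  (pp. 143–144). [WallJLMS1964]
-/

noncomputable section

namespace Literature.Topology.FourManifolds

namespace HomotopySphere

variable {n : ℕ}

/-- **Kervaire–Milnor 1963, p. 505 (Remark, from Smale): two homotopy `n`-spheres, `n ≥ 5`, are
h-cobordant iff they are diffeomorphic — the named fact
`HomotopySphere.isHCobordant_iff_nonempty_diffeomorph_of_five_le` holds**
(`isHCobordant_iff_nonempty_diffeomorph_of_five_le_of_two_leaves` applied to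
`Cobordism.Milnor1965_basisTheorem_slab_holds` and `Milnor1965_whitney_isotopy_holds`).
[cite: KervaireMilnorAnnals1963, p. 505 (Remark, from Smale [26])]
[cite: MilnorHCobordism1965, proof of Thm. 9.1 (PDF p. 57), with Thm. 7.6 (PDF p. 50) and Thm. 6.6 (PDF pp. 38–39)] -/
theorem isHCobordant_iff_nonempty_diffeomorph_of_five_le_holds :
    isHCobordant_iff_nonempty_diffeomorph_of_five_le (n := n) :=
  isHCobordant_iff_nonempty_diffeomorph_of_five_le_of_two_leaves
    Cobordism.Milnor1965_basisTheorem_slab_holds Milnor1965_whitney_isotopy_holds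

/-- **The closed model of a null-cobordism of a homotopy `n`-sphere (`n ≥ 5`) is a charted smooth
manifold — the named fact `HomotopySphere.nonempty_chartedSpace_closedModel` holds**
(`nonempty_chartedSpace_closedModel_of_three_leaves` applied to the three `_holds`).
[cite: MilnorHCobordism1965, Thm. 9.1 (PDF p. 57), with Thm. 7.6, Cor. 7.3, Thm. 6.6]
[cite: Kosinski1993, Ch. X, proof of (3.3), with VIII.(4.6)] -/
theorem nonempty_chartedSpace_closedModel_holds : nonempty_chartedSpace_closedModel :=
  nonempty_chartedSpace_closedModel_of_three_leaves Cobordism.Milnor1965_basisTheorem_slab_holds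
    Cobordism.Milnor1965_intersectionNumber_slab_holds Milnor1965_whitney_isotopy_holds

end HomotopySphere

/-- **Kervaire–Milnor 1963, Thm. 1.1 with §2, for `n ≠ 3`: `Θₙ` is an abelian group under connected
sum — the named fact `exists_commGroup_homotopySphereClass_of_ne_three` holds**
(`exists_commGroup_homotopySphereClass_of_ne_three_of_two_leaves` applied to
`Cobordism.Milnor1965_basisTheorem_slab_holds` and `Milnor1965_whitney_isotopy_holds`).
[cite: KervaireMilnorAnnals1963, Thm. 1.1 (p. 504), Remark p. 505, §2 pp. 505–507]
[cite: MilnorHCobordism1965, Thm. 9.2 (PDF p. 57), Thm. 7.6 (PDF p. 50), Thm. 6.6 and Remark (PDF pp. 38–39)] -/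
theorem exists_commGroup_homotopySphereClass_of_ne_three_holds :
    exists_commGroup_homotopySphereClass_of_ne_three :=
  exists_commGroup_homotopySphereClass_of_ne_three_of_two_leaves
    Cobordism.Milnor1965_basisTheorem_slab_holds Milnor1965_whitney_isotopy_holds

/-- **Wall 1964, Lemma 2 — the named fact `exists_handlebody_isHCobordant_boundary` holds**: if the
simply connected closed smooth `4`-manifold `M` bounds a compact `W` with `W` simply connected,
`Hᵢ(W; ℤ) = 0` for `i ≥ 3` and `H₂(W; ℤ)` finitely generated free of rank `k`, then there is a
handlebody `H = ℋ(D⁵, k, 2)` with `M` h-cobordant to `∂H`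
(`exists_handlebody_isHCobordant_boundary_of_basisTheorem` applied to
`Cobordism.Milnor1965_basisTheorem_slab_holds`).
[cite: WallJLMS1964, Lemma 2 and its proof (pp. 143–144)] [cite: MilnorHCobordism1965, Thm. 7.6 (PDF p. 50)] -/
theorem exists_handlebody_isHCobordant_boundary_holds : exists_handlebody_isHCobordant_boundary :=
  exists_handlebody_isHCobordant_boundary_of_basisTheorem Cobordism.Milnor1965_basisTheorem_slab_holds

end Literature.Topology.FourManifolds

end
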